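import Literature.NumberTheory.FaltingsSerre.Paramodular349
import Literature.NumberTheory.FaltingsSerre.CriterionProofs
import HarnessLib

/-!
# `A₃₄₉` is paramodular of level `349` away from `349`, from the frozen certificate — criterion discharged

[BPPTVY] = A. Brumer, A. Pacetti, C. Poor, G. Tornaría, J. Voight, D. S. Yuen, *On the paramodularity of
typical abelian surfaces*, Algebra & Number Theory **13**:5 (2019) 1145–1195 [cite: BrumerEtAl2019].
[PY15] = C. Poor, D. S. Yuen, *Paramodular cusp forms*, Math. Comp. **84** (2015) 1401–1438
[cite: PoorYuen2015]: Thm 1.2 (p. 1402: for primes `p < 600` outside `{277, 349, 353, 389, 461, 523, 587}`,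
`S₂(K(p))` is spanned by Gritsenko lifts), §7 p. 1432 ("there is at most one nonlift in each S₂²(K(p))";
`f = Q/L` with `Q`, `Q̂`, `L`, `L̂` "at [the website] for each case", conjectural there except for `p = 277`)
and Table 5 (p. 1433: column `349`, `dim J₂,₃₄₉ = 11`, `dim S₂²(K(349)) = 12`, congruence prime `13`,
`λ₂ = −2`, `λ₃ = −1`, `λ₄ = 1`, `λ₅ = −1`, `λ₇ = −2`, `λ₉ = 1`, `λ₁₁ = 1`).  [PSY20] = C. Poor, J. Shurman,
D. S. Yuen, *Nonlift weight two paramodular eigenform constructions*, J. Korean Math. Soc. **57** (2020),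
no. 2, 507–522 [cite: PoorShurmanYuen2020] (the PRINTED text; arXiv:1805.04137v1 states Thm 1.1 only):
Thm 1.1 (p. 508: `dim J^cusp_{2,349} = 11`, `dim S₂(K(349))⁺ = 12`, `dim S₂(K(349))⁻ = 0` — existence and
uniqueness of the nonlift eigenform `f₃₄₉`), Thm 1.2 (p. 509, proof §6 pp. 520–521: "The conjectured
nonlift eigenform formulas `f_N = Q_N/L_N` of [PY15] and its website are correct for
`N = 349, 353, 389, 461, 523, 587±`" — the printed justification of the website formula `QL-349.txt` that
two of the certificate's form-side implementations evaluate by restriction to modular curves), §4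
(p. 517, Figure 1: level `349`, Case 1, `m = 22` — the inflation-method Jacobi form `ψ₃₄₉` whose
Borcherds product gives the nonlift; p. 509: the website's expression of `f₃₄₉` as a linear combination of
that Borcherds product and a Gritsenko lift is "new to this article" — the construction the certificate's
third form-side line expands).

`Literature.NumberTheory.FaltingsSerre.Paramodular349.paramodular_349` (p183469, instance of
`ParamodularTemplate.lean` for the frozen certificate `certs/349/certificate.canonical.json`, sha256
`0b9d070d407f6211ba094695ef509e92c9ce0838fa2e62a6110db86c60cabd92`) carries the hypothesis
`hFS : traceEq_of_faltingsSerre_symplectic` (the Faltings–Serre criterion [BPPTVY, Thm. 2.1.5 /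
Alg. 2.4.1] as a named statement).  That statement is PROVED in the tree
(`Literature.NumberTheory.FaltingsSerre.traceEq_of_faltingsSerre_symplectic_holds`, `CriterionProofs.lean`),
so — exactly as `ParamodularUnconditional.paramodular_277_holds` does for `N = 277` — this file restates
`paramodular_349` WITHOUT `hFS`.  Remaining binders: the certificate `hC` (discharged outside the kernel,
every datum by two independent implementations; referee rulings in the cell's REFEREE.md), the `A`-side
frame/Euler data, the cited `ρ_{f,2}` of [BPPTVY, Thm. 4.3.4] (`hρf`), the form data, and the hand check at
`p = 2`.  No new mathematics; paramodularity of `A₃₄₉` is not a published theorem (the cell's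
FRESHNESS-349.md), which is why the certificate stays a binder.
-/

noncomputable section

namespace Literature.NumberTheory.FaltingsSerre.Paramodular349

open Polynomial IsDedekindDomain
open Literature.NumberTheory.FaltingsSerre Literature.NumberTheory.GaloisRepresentations
  Literature.NumberTheory.Automorphic.Paramodular Literature.NumberTheory.Automorphic
  Literature.AlgebraicGeometry.Motives
open scoped NumberField

/-- **`A₃₄₉` is paramodular of level `349` away from `349` — criterion discharged**: the statement of
`paramodular_349` without `hFS`, supplied by `traceEq_of_faltingsSerre_symplectic_holds`
([BPPTVY, Thm. 2.1.5 p. 1150 / Alg. 2.4.1 p. 1155], proved in `CriterionProofs.lean`). [cite: BrumerEtAl2019, Thm 2.1.5 p. 1150; Alg 2.4.1 p. 1155 (proof of correctness p. 1156); Thm 4.3.4 p. 1169; PoorYuen2015, Thm 1.2 p. 1402, Table 5 p. 1433; PoorShurmanYuen2020, Thm 1.1 p. 508, Thm 1.2 p. 509] -/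
theorem paramodular_349_holds
    {A : AbelianVariety ℚ} {f : Matrix (Fin 2) (Fin 2) ℂ → ℂ}
    {ρA ρf : FramedGaloisRep ℚ ℤ_[2] 4} {J : Matrix (Fin 4) (Fin 4) ℤ_[2]}
    {ν : Field.absoluteGaloisGroup ℚ → ℤ_[2]}
    {b : Module.Basis (Fin 4) ℚ_[2] (A.rationalTateModule 2)}
    (hC : Certificate349 J ν ρA ρf)
    (hframe : A.IsFrameOfTateRep 2 b (rationalize ρA))
    (aA bA af bf : ℕ → ℤ)
    (hA : ∀ p : ℕ, p.Prime → ¬ p ∣ 349 →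
      A.HasGoodEulerFactorAt p ((lPolynomialOfSurface p (aA p) (bA p)).map (Int.castRingHom ℚ)))
    (hρf : ∀ p : ℕ, p.Prime → ¬ p ∣ 349 → p ≠ 2 →
      ∀ v : HeightOneSpectrum (𝓞 ℚ), ((p : ℕ) : 𝓞 ℚ) ∈ v.asIdeal →
        ρf.HasFrobCharpolyAt v
          ((lPolynomialOfSurface p (af p) (bf p)).reverse.map (Int.castRingHom ℤ_[2])))
    (hcusp : IsParamodularCuspForm 349 2 f) (hne : ∃ Z ∈ siegelUpperHalfSpace 2, f Z ≠ 0)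
    (hfe : ∀ p : ℕ, p.Prime → ¬ p ∣ 349 →
      HasSpinorEulerFactorAt 2 p f ((lPolynomialOfSurface p (af p) (bf p)).map (Int.castRingHom ℂ)))
    (h2 : aA 2 = af 2 ∧ bA 2 = bf 2) :
    IsParamodularAwayFrom A 349 f :=
  paramodular_349 traceEq_of_faltingsSerre_symplectic_holds hC hframe aA bA af bf hA hρf hcusp hne hfe h2

end Literature.NumberTheory.FaltingsSerre.Paramodular349

end
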